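import Summits.HodgeConjecture.CorCM.IrreducibleOddWeightsHodgeEquivalence
import Summits.HodgeConjecture.CorCM.IrreducibleOddWeightsCommutantDominationCMFields
import HarnessLib

/-!
# Sub-family domination, II-CM: HODGE EQUIVALENCE for CM fields — `MC₀ = MC₁` IFF
# `cmFamilyRank(Φ₀,Φ₁) = cmTypeRank Φ₀ = cmTypeRank Φ₁`; in an isotypic class IFF `D⟨b⟩ = D⟨b′⟩`

COR-CM (cell `pub-hodgecm2`, binder seat `b16` gen 74, count-neutral claim SUB-FAMILY DOMINATION AND HODGE
EQUIVALENCE, file S2-CM — the CM dress of file S2 `…HodgeEquivalence` (`G = Aut(ℂ)`, slots `Hom(K_i, ℂ)`);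
theorems only, no definition, no named fact, no `sorry`).  NEW as stated, hence under `Summits/`.  HONEST FRAMING:
statements about `cmTypeRank Φ_i = dim MT(A_i)` and `cmFamilyRank = dim MT(∏_i A_i)` (tree, Pohlmann / Deligne) and
the matrix-coefficient spaces `MC_i = span{g ↦ u_i(g ∘ x) : x ∈ Hom(K_i, ℂ)} ≤ ℚ^{Aut(ℂ)}` (`= X^*(MT(A_i))_ℚ`, gen 64
R1/R2).  `A₀` and `A₁` are HODGE-EQUIVALENT when `MC₀ = MC₁`: each is Hodge-dominated by the other,
`MT(A₀ × A₁) → MT(A_i)` are both isogenies.  Nothing is claimed about the algebraicity of Hodge classes; `HC_CM` is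
neither used nor asserted.

* §1 `cmTypeRank_eq_of_span_coeff_eq`; **`span_coeff_eq_iff_le_and_cmTypeRank_eq`** (`MC₁ = MC₀ ⟺ MC₁ ≤ MC₀ ∧
  dim MT(A₁) = dim MT(A₀)`); **`span_coeff_eq_iff_cmFamilyRank_eq_and_eq_of_pair`** (`⟺ dim MT(A₀ × A₁) = dim MT(A₀)
  = dim MT(A₁)`); `span_coeff_eq_iff_cmTypeRank_eq_of_dominated`; blocks `S, T ⊆ I`:
  `iSup_span_coeff_eq_iff_cmFamilyRank_eq_and_eq_of_union`, `iSup_span_coeff_eq_iff_le_and_cmFamilyRank_eq`.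
* §2 IN AN ISOTYPIC CLASS (reference `Aut(ℂ)`-stable irreducible `A ≤ ℚ^Y`, commutant `𝒟` ANY; both type vectors
  `u₀ = Σ_j ι⁰_j(b_j)`, `u₁ = Σ_k ι¹_k(b′_k)` assembled from `A`): `cmTypeRank_mul_eq_of_commutant` (**`dim MT(A_Φ)·δ =
  δ + dim D⟨b⟩·dim A`**), `span_coeff_le_iff_iSup_le_of_commutant`, **`span_coeff_eq_iff_iSup_eq_of_commutant`**
  (`MC₁ = MC₀ ⟺ D⟨b′⟩ = D⟨b⟩`), `cmTypeRank_eq_cmTypeRank_iff_finrank_iSup_eq_of_commutant`.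
* §3 ONE COMPONENT PER SIDE (`b, b′ ≠ 0`): `span_coeff_eq_iff_map_applyₗ_eq_of_commutant`,
  **`span_coeff_le_iff_span_coeff_eq_of_commutant`** (domination is MUTUAL),
  **`cmFamilyRank_eq_cmTypeRank_iff_swap_of_commutant`** (`dim MT(A₀×A₁) = dim MT(A₀) ⟺ dim MT(A₀×A₁) = dim MT(A₁)`).

## References

* [Deligne1982HodgeCycles] P. Deligne, *Hodge cycles on abelian varieties*, LNM 900 (1982), I.3.4, I.5 (p. 53),
  I Ex. 3.7.
* [Gordon1999HodgeAVSurvey] B. B. Gordon, *A survey of the Hodge conjecture for abelian varieties*, §3 Theorem (Imai,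
  Murty) with proof, 7.5–7.7, 9.4.3.
* [Lang2002] S. Lang, *Algebra*, 3rd ed., XVII §1 Prop. 1.1 and §3.
* [Ribet1980] K. A. Ribet, *Division fields of abelian varieties with complex multiplication*, Mém. SMF 2 (1980),
  §3 (3.3).
-/

set_option autoImplicit false

noncomputable section

open scoped BigOperators Classical

universe vY

namespace Summit.HodgeConjecture.CorCM

open CategoryTheory CategoryTheory.Limits NumberField Module IntermediateField
open Literature.NumberTheory.ComplexMultiplication
open Literature.AlgebraicGeometry.Motives (AbelianVariety CMType)
open Literature.AlgebraicGeometry.Motives.AbelianVariety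
open Literature.AlgebraicGeometry.HodgeTheory
open Literature.AlgebraicGeometry.ComplexMultiplication (IsCMTypeRealisation)
open Literature.AlgebraicGeometry.Pohlmann1968

variable {I : Type} [Fintype I] {K : I → Type} [∀ i, Field (K i)] [∀ i, NumberField (K i)] [∀ i, IsCMField (K i)]
  {Y : Type vY} [MulAction (ℂ ≃+* ℂ) Y] [Fintype Y]

/-! ### §1 Matrix-coefficient spaces -/

omit [Fintype I] in
/-- **HODGE-EQUIVALENT CM abelian varieties have Mumford–Tate groups of the same dimension**: `MC₀ = MC₁ ⟹
cmTypeRank Φ₀ = cmTypeRank Φ₁`. [cite: Deligne1982HodgeCycles, I.3.4 and I.5 (p. 53)] [cite: Ribet1980, §3 (3.3)] -/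
theorem cmTypeRank_eq_of_span_coeff_eq (Φ : ∀ i, CMType (K i)) {i₀ i₁ : I}
    (heq : Submodule.span ℚ (Set.range fun x : K i₀ →+* ℂ => fun g : ℂ ≃+* ℂ => antiVec (Φ i₀).1 g x) =
      Submodule.span ℚ (Set.range fun x : K i₁ →+* ℂ => fun g : ℂ ≃+* ℂ => antiVec (Φ i₁).1 g x)) :
    cmTypeRank (Φ i₀) = cmTypeRank (Φ i₁) := by
  haveI : ∀ i, Nonempty (K i →+* ℂ) := fun i => inferInstance
  exact IrrOdd.typeRank_eq_of_span_coeff_eq (G := ℂ ≃+* ℂ) (E := fun i => K i →+* ℂ) (Φ := fun i => (Φ i).1)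
    (fun i => isCMTypeWith_conj (Φ i)) heq

omit [Fintype I] in
/-- **`MC₁ = MC₀ ⟺ MC₁ ≤ MC₀ ∧ cmTypeRank Φ₁ = cmTypeRank Φ₀`**: Hodge equivalence is Hodge domination plus
`dim MT(A₁) = dim MT(A₀)`. [cite: Deligne1982HodgeCycles, I.5 (p. 53)] [cite: Gordon1999HodgeAVSurvey, §3 Theorem
(proof), 7.7] -/
theorem span_coeff_eq_iff_le_and_cmTypeRank_eq (Φ : ∀ i, CMType (K i)) (i₀ i₁ : I) :
    Submodule.span ℚ (Set.range fun x : K i₁ →+* ℂ => fun g : ℂ ≃+* ℂ => antiVec (Φ i₁).1 g x) =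
        Submodule.span ℚ (Set.range fun x : K i₀ →+* ℂ => fun g : ℂ ≃+* ℂ => antiVec (Φ i₀).1 g x) ↔
      Submodule.span ℚ (Set.range fun x : K i₁ →+* ℂ => fun g : ℂ ≃+* ℂ => antiVec (Φ i₁).1 g x) ≤
          Submodule.span ℚ (Set.range fun x : K i₀ →+* ℂ => fun g : ℂ ≃+* ℂ => antiVec (Φ i₀).1 g x) ∧
        cmTypeRank (Φ i₁) = cmTypeRank (Φ i₀) := by
  haveI : ∀ i, Nonempty (K i →+* ℂ) := fun i => inferInstance
  exact IrrOdd.span_coeff_eq_iff_le_and_typeRank_eq (G := ℂ ≃+* ℂ) (E := fun i => K i →+* ℂ)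
    (Φ := fun i => (Φ i).1) (fun i => isCMTypeWith_conj (Φ i)) i₀ i₁

/-- **HODGE EQUIVALENCE OF A PAIR (CM fields): `MC₁ = MC₀ ⟺ cmFamilyRank Φ = cmTypeRank Φ₀ ∧ cmFamilyRank Φ =
cmTypeRank Φ₁`** — both projections `MT(A₀ × A₁) → MT(A_i)` are isogenies.
[cite: Deligne1982HodgeCycles, I.5 (p. 53)] [cite: Gordon1999HodgeAVSurvey, §3 Theorem (proof), 7.5–7.7] -/
theorem span_coeff_eq_iff_cmFamilyRank_eq_and_eq_of_pair {i₀ i₁ : I} (hI : ∀ l, l = i₀ ∨ l = i₁)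
    (Φ : ∀ i, CMType (K i)) :
    Submodule.span ℚ (Set.range fun x : K i₁ →+* ℂ => fun g : ℂ ≃+* ℂ => antiVec (Φ i₁).1 g x) =
        Submodule.span ℚ (Set.range fun x : K i₀ →+* ℂ => fun g : ℂ ≃+* ℂ => antiVec (Φ i₀).1 g x) ↔
      CMAlgebra.cmFamilyRank Φ = cmTypeRank (Φ i₀) ∧ CMAlgebra.cmFamilyRank Φ = cmTypeRank (Φ i₁) := by
  haveI : ∀ i, Nonempty (K i →+* ℂ) := fun i => inferInstance
  exact IrrOdd.span_coeff_eq_iff_typeRank_sigmaType_eq_and_eq_of_pair (G := ℂ ≃+* ℂ) (E := fun i => K i →+* ℂ)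
    (Φ := fun i => (Φ i).1) (fun i => isCMTypeWith_conj (Φ i)) hI

/-- **Under domination, equal dimension is equivalence (CM fields)**: if `cmFamilyRank Φ = cmTypeRank Φ₀` then
`cmTypeRank Φ₁ = cmTypeRank Φ₀ ⟺ MC₁ = MC₀`. [cite: Deligne1982HodgeCycles, I.5 (p. 53)]
[cite: Gordon1999HodgeAVSurvey, §3 Theorem (proof), 7.7] -/
theorem span_coeff_eq_iff_cmTypeRank_eq_of_dominated {i₀ i₁ : I} (hI : ∀ l, l = i₀ ∨ l = i₁)
    (Φ : ∀ i, CMType (K i)) (hdom : CMAlgebra.cmFamilyRank Φ = cmTypeRank (Φ i₀)) :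
    Submodule.span ℚ (Set.range fun x : K i₁ →+* ℂ => fun g : ℂ ≃+* ℂ => antiVec (Φ i₁).1 g x) =
        Submodule.span ℚ (Set.range fun x : K i₀ →+* ℂ => fun g : ℂ ≃+* ℂ => antiVec (Φ i₀).1 g x) ↔
      cmTypeRank (Φ i₁) = cmTypeRank (Φ i₀) := by
  haveI : ∀ i, Nonempty (K i →+* ℂ) := fun i => inferInstance
  exact IrrOdd.span_coeff_eq_iff_typeRank_eq_of_dominated (G := ℂ ≃+* ℂ) (E := fun i => K i →+* ℂ)
    (Φ := fun i => (Φ i).1) (fun i => isCMTypeWith_conj (Φ i)) hI hdom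

/-- **HODGE-EQUIVALENT SUB-PRODUCTS (CM fields)**: for `S, T ⊆ I` non-empty, **`MC_T = MC_S ⟺ cmFamilyRank Φ|_{S∪T} =
cmFamilyRank Φ|_S ∧ cmFamilyRank Φ|_{S∪T} = cmFamilyRank Φ|_T`** (`MT(∏_{S∪T} A_i)` is isogenous to both
`MT(∏_S A_i)` and `MT(∏_T A_i)`). [cite: Deligne1982HodgeCycles, I.5 (p. 53)] [cite: Gordon1999HodgeAVSurvey, §3
Theorem (proof), 7.5–7.7] -/
theorem iSup_span_coeff_eq_iff_cmFamilyRank_eq_and_eq_of_union (Φ : ∀ i, CMType (K i)) (S T : Finset I)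
    (hS : S.Nonempty) (hT : T.Nonempty) :
    (⨆ j : T, Submodule.span ℚ (Set.range fun x : K j.1 →+* ℂ => fun g : ℂ ≃+* ℂ => antiVec (Φ j.1).1 g x)) =
        (⨆ j : S, Submodule.span ℚ (Set.range fun x : K j.1 →+* ℂ => fun g : ℂ ≃+* ℂ => antiVec (Φ j.1).1 g x)) ↔
      CMAlgebra.cmFamilyRank (fun j : ↥(S ∪ T) => Φ j.1) = CMAlgebra.cmFamilyRank (fun j : S => Φ j.1) ∧
        CMAlgebra.cmFamilyRank (fun j : ↥(S ∪ T) => Φ j.1) = CMAlgebra.cmFamilyRank (fun j : T => Φ j.1) := by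
  obtain ⟨j₁, hj₁⟩ := hS
  obtain ⟨j₂, hj₂⟩ := hT
  obtain ⟨s₁⟩ : Nonempty (K j₁ →+* ℂ) := inferInstance
  obtain ⟨s₂⟩ : Nonempty (K j₂ →+* ℂ) := inferInstance
  haveI : Nonempty (Σ j : {j // j ∈ S}, (K j.1 →+* ℂ)) := ⟨⟨⟨j₁, hj₁⟩, s₁⟩⟩
  haveI : Nonempty (Σ j : {j // j ∈ T}, (K j.1 →+* ℂ)) := ⟨⟨⟨j₂, hj₂⟩, s₂⟩⟩
  exact IrrOdd.iSup_span_coeff_eq_iff_typeRank_sigmaType_eq_and_eq_of_union (G := ℂ ≃+* ℂ) (E := fun i => K i →+* ℂ)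
    (Φ := fun i => (Φ i).1) (fun i => isCMTypeWith_conj (Φ i)) (· ∈ S) (· ∈ T) (· ∈ S ∪ T)
    (fun i => by rw [Finset.mem_union])

/-- **`MC_T = MC_S ⟺ MC_T ≤ MC_S ∧ cmFamilyRank Φ|_T = cmFamilyRank Φ|_S`** (sub-products `S, T ≠ ∅`).
[cite: Deligne1982HodgeCycles, I.5 (p. 53)] [cite: Gordon1999HodgeAVSurvey, §3 Theorem (proof), 7.7] -/
theorem iSup_span_coeff_eq_iff_le_and_cmFamilyRank_eq (Φ : ∀ i, CMType (K i)) (S T : Finset I) (hS : S.Nonempty)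
    (hT : T.Nonempty) :
    (⨆ j : T, Submodule.span ℚ (Set.range fun x : K j.1 →+* ℂ => fun g : ℂ ≃+* ℂ => antiVec (Φ j.1).1 g x)) =
        (⨆ j : S, Submodule.span ℚ (Set.range fun x : K j.1 →+* ℂ => fun g : ℂ ≃+* ℂ => antiVec (Φ j.1).1 g x)) ↔
      (⨆ j : T, Submodule.span ℚ (Set.range fun x : K j.1 →+* ℂ => fun g : ℂ ≃+* ℂ => antiVec (Φ j.1).1 g x)) ≤
          (⨆ j : S, Submodule.span ℚ (Set.range fun x : K j.1 →+* ℂ => fun g : ℂ ≃+* ℂ => antiVec (Φ j.1).1 g x)) ∧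
        CMAlgebra.cmFamilyRank (fun j : T => Φ j.1) = CMAlgebra.cmFamilyRank (fun j : S => Φ j.1) := by
  obtain ⟨j₁, hj₁⟩ := hS
  obtain ⟨j₂, hj₂⟩ := hT
  obtain ⟨s₁⟩ : Nonempty (K j₁ →+* ℂ) := inferInstance
  obtain ⟨s₂⟩ : Nonempty (K j₂ →+* ℂ) := inferInstance
  haveI : Nonempty (Σ j : {j // j ∈ S}, (K j.1 →+* ℂ)) := ⟨⟨⟨j₁, hj₁⟩, s₁⟩⟩
  haveI : Nonempty (Σ j : {j // j ∈ T}, (K j.1 →+* ℂ)) := ⟨⟨⟨j₂, hj₂⟩, s₂⟩⟩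
  exact IrrOdd.iSup_span_coeff_eq_iff_le_and_typeRank_sigmaType_eq (G := ℂ ≃+* ℂ) (E := fun i => K i →+* ℂ)
    (Φ := fun i => (Φ i).1) (fun i => isCMTypeWith_conj (Φ i)) (· ∈ S) (· ∈ T)

/-! ### §2 In an isotypic class -/

omit [Fintype I] in
/-- **`dim MT(A_Φ)` IN A CLASS: `cmTypeRank Φ₀·δ = δ + dim D⟨b⟩·dim A`** for the type vector `u₀ = Σ_j ι_j(b_j)`
assembled from the reference irreducible `A` (`0 ≠ a₀ ∈ A` names `δ`): `dim Hg(A_{Φ₀})·δ = dim D⟨b⟩·dim A`.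
[cite: Lang2002, XVII §3] [cite: Ribet1980, §3 (3.3)] [cite: Deligne1982HodgeCycles, I.3.4] -/
theorem cmTypeRank_mul_eq_of_commutant (Φ : ∀ i, CMType (K i)) (i₀ : I)
    {A : Submodule ℚ (Y → ℚ)} {𝒟 : Submodule ℚ ((Y → ℚ) →ₗ[ℚ] (Y → ℚ))}
    (h𝒟 : ∀ L : (Y → ℚ) →ₗ[ℚ] (Y → ℚ), L ∈ 𝒟 ↔ (∀ a ∈ A, L a ∈ A) ∧
      ∀ (k : ℂ ≃+* ℂ) (a : Y → ℚ), a ∈ A → L (fun y => a (k • y)) = fun y => L a (k • y))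
    (hAst : ∀ (k : ℂ ≃+* ℂ) (a : Y → ℚ), a ∈ A → (fun y => a (k • y)) ∈ A)
    (hAirr : ∀ W : Submodule ℚ (Y → ℚ), W ≤ A → W ≠ ⊥ →
      (∀ (k : ℂ ≃+* ℂ) (f : Y → ℚ), f ∈ W → (fun y => f (k • y)) ∈ W) → W = A)
    {J₀ : Type} [Fintype J₀] (ι₀ : J₀ → ((Y → ℚ) →ₗ[ℚ] ((K i₀ →+* ℂ) → ℚ)))
    (hι₀eq : ∀ (j : J₀) (k : ℂ ≃+* ℂ) (a : Y → ℚ), a ∈ A → ι₀ j (fun y => a (k • y)) = fun y => ι₀ j a (k • y))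
    (hind₀ : ∀ f : J₀ → (Y → ℚ), (∀ j, f j ∈ A) → ∑ j, ι₀ j (f j) = 0 → ∀ j, f j = 0)
    {b₀ : J₀ → (Y → ℚ)} (hb₀ : ∀ j, b₀ j ∈ A) (hu₀ : antiVec (Φ i₀).1 (1 : ℂ ≃+* ℂ) = ∑ j, ι₀ j (b₀ j))
    {a₀ : Y → ℚ} (ha₀ : a₀ ∈ A) (h0 : a₀ ≠ 0) :
    cmTypeRank (Φ i₀) * Module.finrank ℚ ↥(𝒟.map (LinearMap.applyₗ a₀)) =
      Module.finrank ℚ ↥(𝒟.map (LinearMap.applyₗ a₀)) +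
        Module.finrank ℚ ↥(⨆ j, 𝒟.map (LinearMap.applyₗ (b₀ j))) * Module.finrank ℚ A := by
  haveI : ∀ i, Nonempty (K i →+* ℂ) := fun i => inferInstance
  exact IrrOdd.typeRank_mul_eq_of_class (G := ℂ ≃+* ℂ) (E := fun i => K i →+* ℂ) (Φ := fun i => (Φ i).1)
    (fun i => isCMTypeWith_conj (Φ i)) i₀ h𝒟 hAst hAirr ι₀ hι₀eq hind₀ hb₀ hu₀ ha₀ h0

omit [Fintype I] [∀ i, IsCMField (K i)] in
/-- **`MC₁ ≤ MC₀ ⟺ D⟨b′⟩ ≤ D⟨b⟩` (CM fields)** on the Galois pivots of both slots (`A ≠ 0`): `A₁` is Hodge-dominated by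
`A₀` iff the components of `u₁` are `D`-combinations of those of `u₀`. [cite: Lang2002, XVII §3]
[cite: Gordon1999HodgeAVSurvey, §3 Theorem (proof), 7.5–7.7] -/
theorem span_coeff_le_iff_iSup_le_of_commutant (Φ : ∀ i, CMType (K i)) (i₀ i₁ : I)
    {A : Submodule ℚ (Y → ℚ)} {𝒟 : Submodule ℚ ((Y → ℚ) →ₗ[ℚ] (Y → ℚ))}
    (h𝒟 : ∀ L : (Y → ℚ) →ₗ[ℚ] (Y → ℚ), L ∈ 𝒟 ↔ (∀ a ∈ A, L a ∈ A) ∧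
      ∀ (k : ℂ ≃+* ℂ) (a : Y → ℚ), a ∈ A → L (fun y => a (k • y)) = fun y => L a (k • y))
    (hAst : ∀ (k : ℂ ≃+* ℂ) (a : Y → ℚ), a ∈ A → (fun y => a (k • y)) ∈ A)
    (hAirr : ∀ W : Submodule ℚ (Y → ℚ), W ≤ A → W ≠ ⊥ →
      (∀ (k : ℂ ≃+* ℂ) (f : Y → ℚ), f ∈ W → (fun y => f (k • y)) ∈ W) → W = A)
    (hA0 : A ≠ ⊥) {J₀ J₁ : Type} [Fintype J₀] [Fintype J₁]
    (ι₀ : J₀ → ((Y → ℚ) →ₗ[ℚ] ((K i₀ →+* ℂ) → ℚ))) (ι₁ : J₁ → ((Y → ℚ) →ₗ[ℚ] ((K i₁ →+* ℂ) → ℚ)))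
    (hι₀eq : ∀ (j : J₀) (k : ℂ ≃+* ℂ) (a : Y → ℚ), a ∈ A → ι₀ j (fun y => a (k • y)) = fun y => ι₀ j a (k • y))
    (hι₁eq : ∀ (j : J₁) (k : ℂ ≃+* ℂ) (a : Y → ℚ), a ∈ A → ι₁ j (fun y => a (k • y)) = fun y => ι₁ j a (k • y))
    (hind₀ : ∀ f : J₀ → (Y → ℚ), (∀ j, f j ∈ A) → ∑ j, ι₀ j (f j) = 0 → ∀ j, f j = 0)
    (hind₁ : ∀ f : J₁ → (Y → ℚ), (∀ j, f j ∈ A) → ∑ j, ι₁ j (f j) = 0 → ∀ j, f j = 0)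
    {b₀ : J₀ → (Y → ℚ)} {b₁ : J₁ → (Y → ℚ)} (hb₀ : ∀ j, b₀ j ∈ A) (hb₁ : ∀ j, b₁ j ∈ A)
    (hu₀ : antiVec (Φ i₀).1 (1 : ℂ ≃+* ℂ) = ∑ j, ι₀ j (b₀ j))
    (hu₁ : antiVec (Φ i₁).1 (1 : ℂ ≃+* ℂ) = ∑ j, ι₁ j (b₁ j)) :
    Submodule.span ℚ (Set.range fun x : K i₁ →+* ℂ => fun g : ℂ ≃+* ℂ => antiVec (Φ i₁).1 g x) ≤
        Submodule.span ℚ (Set.range fun x : K i₀ →+* ℂ => fun g : ℂ ≃+* ℂ => antiVec (Φ i₀).1 g x) ↔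
      (⨆ j, 𝒟.map (LinearMap.applyₗ (b₁ j))) ≤ ⨆ j, 𝒟.map (LinearMap.applyₗ (b₀ j)) :=
  IrrOdd.span_coeff_le_iff_iSup_le_of_class (G := ℂ ≃+* ℂ) (E := fun i => K i →+* ℂ) (fun i => (Φ i).1) i₀ i₁ h𝒟
    hAst hAirr hA0 ι₀ ι₁ hι₀eq hι₁eq hind₀ hind₁ hb₀ hb₁ hu₀ hu₁

omit [Fintype I] [∀ i, IsCMField (K i)] in
/-- **HODGE EQUIVALENCE IN A CLASS (CM fields): `MC₁ = MC₀ ⟺ D⟨b′⟩ = D⟨b⟩`** (`A ≠ 0`).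
[cite: Lang2002, XVII §3] [cite: Gordon1999HodgeAVSurvey, §3 Theorem (proof), 7.5–7.7 and 9.4.3] -/
theorem span_coeff_eq_iff_iSup_eq_of_commutant (Φ : ∀ i, CMType (K i)) (i₀ i₁ : I)
    {A : Submodule ℚ (Y → ℚ)} {𝒟 : Submodule ℚ ((Y → ℚ) →ₗ[ℚ] (Y → ℚ))}
    (h𝒟 : ∀ L : (Y → ℚ) →ₗ[ℚ] (Y → ℚ), L ∈ 𝒟 ↔ (∀ a ∈ A, L a ∈ A) ∧
      ∀ (k : ℂ ≃+* ℂ) (a : Y → ℚ), a ∈ A → L (fun y => a (k • y)) = fun y => L a (k • y))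
    (hAst : ∀ (k : ℂ ≃+* ℂ) (a : Y → ℚ), a ∈ A → (fun y => a (k • y)) ∈ A)
    (hAirr : ∀ W : Submodule ℚ (Y → ℚ), W ≤ A → W ≠ ⊥ →
      (∀ (k : ℂ ≃+* ℂ) (f : Y → ℚ), f ∈ W → (fun y => f (k • y)) ∈ W) → W = A)
    (hA0 : A ≠ ⊥) {J₀ J₁ : Type} [Fintype J₀] [Fintype J₁]
    (ι₀ : J₀ → ((Y → ℚ) →ₗ[ℚ] ((K i₀ →+* ℂ) → ℚ))) (ι₁ : J₁ → ((Y → ℚ) →ₗ[ℚ] ((K i₁ →+* ℂ) → ℚ)))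
    (hι₀eq : ∀ (j : J₀) (k : ℂ ≃+* ℂ) (a : Y → ℚ), a ∈ A → ι₀ j (fun y => a (k • y)) = fun y => ι₀ j a (k • y))
    (hι₁eq : ∀ (j : J₁) (k : ℂ ≃+* ℂ) (a : Y → ℚ), a ∈ A → ι₁ j (fun y => a (k • y)) = fun y => ι₁ j a (k • y))
    (hind₀ : ∀ f : J₀ → (Y → ℚ), (∀ j, f j ∈ A) → ∑ j, ι₀ j (f j) = 0 → ∀ j, f j = 0)
    (hind₁ : ∀ f : J₁ → (Y → ℚ), (∀ j, f j ∈ A) → ∑ j, ι₁ j (f j) = 0 → ∀ j, f j = 0)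
    {b₀ : J₀ → (Y → ℚ)} {b₁ : J₁ → (Y → ℚ)} (hb₀ : ∀ j, b₀ j ∈ A) (hb₁ : ∀ j, b₁ j ∈ A)
    (hu₀ : antiVec (Φ i₀).1 (1 : ℂ ≃+* ℂ) = ∑ j, ι₀ j (b₀ j))
    (hu₁ : antiVec (Φ i₁).1 (1 : ℂ ≃+* ℂ) = ∑ j, ι₁ j (b₁ j)) :
    Submodule.span ℚ (Set.range fun x : K i₁ →+* ℂ => fun g : ℂ ≃+* ℂ => antiVec (Φ i₁).1 g x) =
        Submodule.span ℚ (Set.range fun x : K i₀ →+* ℂ => fun g : ℂ ≃+* ℂ => antiVec (Φ i₀).1 g x) ↔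
      (⨆ j, 𝒟.map (LinearMap.applyₗ (b₁ j))) = ⨆ j, 𝒟.map (LinearMap.applyₗ (b₀ j)) :=
  IrrOdd.span_coeff_eq_iff_iSup_eq_of_class (G := ℂ ≃+* ℂ) (E := fun i => K i →+* ℂ) (fun i => (Φ i).1) i₀ i₁ h𝒟
    hAst hAirr hA0 ι₀ ι₁ hι₀eq hι₁eq hind₀ hind₁ hb₀ hb₁ hu₀ hu₁

omit [Fintype I] in
/-- **`cmTypeRank Φ₀ = cmTypeRank Φ₁ ⟺ dim D⟨b⟩ = dim D⟨b′⟩`** in one isotypic class (`A ≠ 0`): `dim MT(A₀) =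
dim MT(A₁)` iff the components of the two type vectors span `D`-submodules of the same dimension.
[cite: Lang2002, XVII §3] [cite: Ribet1980, §3 (3.3)] -/
theorem cmTypeRank_eq_cmTypeRank_iff_finrank_iSup_eq_of_commutant (Φ : ∀ i, CMType (K i)) (i₀ i₁ : I)
    {A : Submodule ℚ (Y → ℚ)} {𝒟 : Submodule ℚ ((Y → ℚ) →ₗ[ℚ] (Y → ℚ))}
    (h𝒟 : ∀ L : (Y → ℚ) →ₗ[ℚ] (Y → ℚ), L ∈ 𝒟 ↔ (∀ a ∈ A, L a ∈ A) ∧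
      ∀ (k : ℂ ≃+* ℂ) (a : Y → ℚ), a ∈ A → L (fun y => a (k • y)) = fun y => L a (k • y))
    (hAst : ∀ (k : ℂ ≃+* ℂ) (a : Y → ℚ), a ∈ A → (fun y => a (k • y)) ∈ A)
    (hAirr : ∀ W : Submodule ℚ (Y → ℚ), W ≤ A → W ≠ ⊥ →
      (∀ (k : ℂ ≃+* ℂ) (f : Y → ℚ), f ∈ W → (fun y => f (k • y)) ∈ W) → W = A)
    (hA0 : A ≠ ⊥) {J₀ J₁ : Type} [Fintype J₀] [Fintype J₁]
    (ι₀ : J₀ → ((Y → ℚ) →ₗ[ℚ] ((K i₀ →+* ℂ) → ℚ))) (ι₁ : J₁ → ((Y → ℚ) →ₗ[ℚ] ((K i₁ →+* ℂ) → ℚ)))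
    (hι₀eq : ∀ (j : J₀) (k : ℂ ≃+* ℂ) (a : Y → ℚ), a ∈ A → ι₀ j (fun y => a (k • y)) = fun y => ι₀ j a (k • y))
    (hι₁eq : ∀ (j : J₁) (k : ℂ ≃+* ℂ) (a : Y → ℚ), a ∈ A → ι₁ j (fun y => a (k • y)) = fun y => ι₁ j a (k • y))
    (hind₀ : ∀ f : J₀ → (Y → ℚ), (∀ j, f j ∈ A) → ∑ j, ι₀ j (f j) = 0 → ∀ j, f j = 0)
    (hind₁ : ∀ f : J₁ → (Y → ℚ), (∀ j, f j ∈ A) → ∑ j, ι₁ j (f j) = 0 → ∀ j, f j = 0)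
    {b₀ : J₀ → (Y → ℚ)} {b₁ : J₁ → (Y → ℚ)} (hb₀ : ∀ j, b₀ j ∈ A) (hb₁ : ∀ j, b₁ j ∈ A)
    (hu₀ : antiVec (Φ i₀).1 (1 : ℂ ≃+* ℂ) = ∑ j, ι₀ j (b₀ j))
    (hu₁ : antiVec (Φ i₁).1 (1 : ℂ ≃+* ℂ) = ∑ j, ι₁ j (b₁ j)) :
    cmTypeRank (Φ i₀) = cmTypeRank (Φ i₁) ↔
      Module.finrank ℚ ↥(⨆ j, 𝒟.map (LinearMap.applyₗ (b₀ j))) =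
        Module.finrank ℚ ↥(⨆ j, 𝒟.map (LinearMap.applyₗ (b₁ j))) := by
  haveI : ∀ i, Nonempty (K i →+* ℂ) := fun i => inferInstance
  exact IrrOdd.typeRank_eq_typeRank_iff_finrank_iSup_eq_of_class (G := ℂ ≃+* ℂ) (E := fun i => K i →+* ℂ)
    (Φ := fun i => (Φ i).1) (fun i => isCMTypeWith_conj (Φ i)) i₀ i₁ h𝒟 hAst hAirr hA0 ι₀ ι₁ hι₀eq hι₁eq hind₀
    hind₁ hb₀ hb₁ hu₀ hu₁

/-! ### §3 One component per side: domination is mutual -/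

omit [Fintype I] [∀ i, IsCMField (K i)] in
/-- **`MC₁ = MC₀ ⟺ D·b′ = D·b` (CM fields)** for single-component type vectors `u₀ = ι⁰(b)`, `u₁ = ι¹(b′)`
(equivariant embeddings injective on `A ≠ 0`). [cite: Lang2002, XVII §1 Prop. 1.1 and §3] -/
theorem span_coeff_eq_iff_map_applyₗ_eq_of_commutant (Φ : ∀ i, CMType (K i)) (i₀ i₁ : I)
    {A : Submodule ℚ (Y → ℚ)} {𝒟 : Submodule ℚ ((Y → ℚ) →ₗ[ℚ] (Y → ℚ))}
    (h𝒟 : ∀ L : (Y → ℚ) →ₗ[ℚ] (Y → ℚ), L ∈ 𝒟 ↔ (∀ a ∈ A, L a ∈ A) ∧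
      ∀ (k : ℂ ≃+* ℂ) (a : Y → ℚ), a ∈ A → L (fun y => a (k • y)) = fun y => L a (k • y))
    (hAst : ∀ (k : ℂ ≃+* ℂ) (a : Y → ℚ), a ∈ A → (fun y => a (k • y)) ∈ A)
    (hAirr : ∀ W : Submodule ℚ (Y → ℚ), W ≤ A → W ≠ ⊥ →
      (∀ (k : ℂ ≃+* ℂ) (f : Y → ℚ), f ∈ W → (fun y => f (k • y)) ∈ W) → W = A)
    (hA0 : A ≠ ⊥) (ι₀ : (Y → ℚ) →ₗ[ℚ] ((K i₀ →+* ℂ) → ℚ)) (ι₁ : (Y → ℚ) →ₗ[ℚ] ((K i₁ →+* ℂ) → ℚ))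
    (hι₀eq : ∀ (k : ℂ ≃+* ℂ) (a : Y → ℚ), a ∈ A → ι₀ (fun y => a (k • y)) = fun y => ι₀ a (k • y))
    (hι₁eq : ∀ (k : ℂ ≃+* ℂ) (a : Y → ℚ), a ∈ A → ι₁ (fun y => a (k • y)) = fun y => ι₁ a (k • y))
    (hinj₀ : ∀ f ∈ A, ι₀ f = 0 → f = 0) (hinj₁ : ∀ f ∈ A, ι₁ f = 0 → f = 0)
    {b₀ b₁ : Y → ℚ} (hb₀ : b₀ ∈ A) (hb₁ : b₁ ∈ A)
    (hu₀ : antiVec (Φ i₀).1 (1 : ℂ ≃+* ℂ) = ι₀ b₀) (hu₁ : antiVec (Φ i₁).1 (1 : ℂ ≃+* ℂ) = ι₁ b₁) :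
    Submodule.span ℚ (Set.range fun x : K i₁ →+* ℂ => fun g : ℂ ≃+* ℂ => antiVec (Φ i₁).1 g x) =
        Submodule.span ℚ (Set.range fun x : K i₀ →+* ℂ => fun g : ℂ ≃+* ℂ => antiVec (Φ i₀).1 g x) ↔
      𝒟.map (LinearMap.applyₗ b₁) = 𝒟.map (LinearMap.applyₗ b₀) :=
  IrrOdd.span_coeff_eq_iff_map_applyₗ_eq_single (G := ℂ ≃+* ℂ) (E := fun i => K i →+* ℂ) (fun i => (Φ i).1) i₀ i₁
    h𝒟 hAst hAirr hA0 ι₀ ι₁ hι₀eq hι₁eq hinj₀ hinj₁ hb₀ hb₁ hu₀ hu₁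

omit [Fintype I] [∀ i, IsCMField (K i)] in
/-- **FOR SINGLE COMPONENTS, HODGE DOMINATION IS MUTUAL (CM fields): `MC₁ ≤ MC₀ ⟺ MC₁ = MC₀`** (`b, b′ ≠ 0`):
D-lines are equal or disjoint. [cite: Lang2002, XVII §1 Prop. 1.1] [cite: Gordon1999HodgeAVSurvey, §3 Theorem
(proof), 7.5–7.7] -/
theorem span_coeff_le_iff_span_coeff_eq_of_commutant (Φ : ∀ i, CMType (K i)) (i₀ i₁ : I)
    {A : Submodule ℚ (Y → ℚ)} {𝒟 : Submodule ℚ ((Y → ℚ) →ₗ[ℚ] (Y → ℚ))}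
    (h𝒟 : ∀ L : (Y → ℚ) →ₗ[ℚ] (Y → ℚ), L ∈ 𝒟 ↔ (∀ a ∈ A, L a ∈ A) ∧
      ∀ (k : ℂ ≃+* ℂ) (a : Y → ℚ), a ∈ A → L (fun y => a (k • y)) = fun y => L a (k • y))
    (hAst : ∀ (k : ℂ ≃+* ℂ) (a : Y → ℚ), a ∈ A → (fun y => a (k • y)) ∈ A)
    (hAirr : ∀ W : Submodule ℚ (Y → ℚ), W ≤ A → W ≠ ⊥ →
      (∀ (k : ℂ ≃+* ℂ) (f : Y → ℚ), f ∈ W → (fun y => f (k • y)) ∈ W) → W = A)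
    (ι₀ : (Y → ℚ) →ₗ[ℚ] ((K i₀ →+* ℂ) → ℚ)) (ι₁ : (Y → ℚ) →ₗ[ℚ] ((K i₁ →+* ℂ) → ℚ))
    (hι₀eq : ∀ (k : ℂ ≃+* ℂ) (a : Y → ℚ), a ∈ A → ι₀ (fun y => a (k • y)) = fun y => ι₀ a (k • y))
    (hι₁eq : ∀ (k : ℂ ≃+* ℂ) (a : Y → ℚ), a ∈ A → ι₁ (fun y => a (k • y)) = fun y => ι₁ a (k • y))
    (hinj₀ : ∀ f ∈ A, ι₀ f = 0 → f = 0) (hinj₁ : ∀ f ∈ A, ι₁ f = 0 → f = 0)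
    {b₀ b₁ : Y → ℚ} (hb₀ : b₀ ∈ A) (hb₁ : b₁ ∈ A) (hb₀0 : b₀ ≠ 0) (hb₁0 : b₁ ≠ 0)
    (hu₀ : antiVec (Φ i₀).1 (1 : ℂ ≃+* ℂ) = ι₀ b₀) (hu₁ : antiVec (Φ i₁).1 (1 : ℂ ≃+* ℂ) = ι₁ b₁) :
    Submodule.span ℚ (Set.range fun x : K i₁ →+* ℂ => fun g : ℂ ≃+* ℂ => antiVec (Φ i₁).1 g x) ≤
        Submodule.span ℚ (Set.range fun x : K i₀ →+* ℂ => fun g : ℂ ≃+* ℂ => antiVec (Φ i₀).1 g x) ↔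
      Submodule.span ℚ (Set.range fun x : K i₁ →+* ℂ => fun g : ℂ ≃+* ℂ => antiVec (Φ i₁).1 g x) =
        Submodule.span ℚ (Set.range fun x : K i₀ →+* ℂ => fun g : ℂ ≃+* ℂ => antiVec (Φ i₀).1 g x) :=
  IrrOdd.span_coeff_le_iff_span_coeff_eq_single (G := ℂ ≃+* ℂ) (E := fun i => K i →+* ℂ) (fun i => (Φ i).1) i₀ i₁
    h𝒟 hAst hAirr ι₀ ι₁ hι₀eq hι₁eq hinj₀ hinj₁ hb₀ hb₁ hb₀0 hb₁0 hu₀ hu₁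

/-- **`cmFamilyRank Φ = cmTypeRank Φ₀ ⟺ cmFamilyRank Φ = cmTypeRank Φ₁`** for a pair with single-component type
vectors (`b, b′ ≠ 0`): `dim MT(A₀ × A₁) = dim MT(A₀)` iff `= dim MT(A₁)` — `A₁` is Hodge-dominated by `A₀` iff
`A₀` is by `A₁`. [cite: Gordon1999HodgeAVSurvey, §3 Theorem (proof), 7.5–7.7] [cite: Lang2002, XVII §1 Prop. 1.1] -/
theorem cmFamilyRank_eq_cmTypeRank_iff_swap_of_commutant {i₀ i₁ : I} (hI : ∀ l, l = i₀ ∨ l = i₁)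
    (Φ : ∀ i, CMType (K i)) {A : Submodule ℚ (Y → ℚ)} {𝒟 : Submodule ℚ ((Y → ℚ) →ₗ[ℚ] (Y → ℚ))}
    (h𝒟 : ∀ L : (Y → ℚ) →ₗ[ℚ] (Y → ℚ), L ∈ 𝒟 ↔ (∀ a ∈ A, L a ∈ A) ∧
      ∀ (k : ℂ ≃+* ℂ) (a : Y → ℚ), a ∈ A → L (fun y => a (k • y)) = fun y => L a (k • y))
    (hAst : ∀ (k : ℂ ≃+* ℂ) (a : Y → ℚ), a ∈ A → (fun y => a (k • y)) ∈ A)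
    (hAirr : ∀ W : Submodule ℚ (Y → ℚ), W ≤ A → W ≠ ⊥ →
      (∀ (k : ℂ ≃+* ℂ) (f : Y → ℚ), f ∈ W → (fun y => f (k • y)) ∈ W) → W = A)
    (ι₀ : (Y → ℚ) →ₗ[ℚ] ((K i₀ →+* ℂ) → ℚ)) (ι₁ : (Y → ℚ) →ₗ[ℚ] ((K i₁ →+* ℂ) → ℚ))
    (hι₀eq : ∀ (k : ℂ ≃+* ℂ) (a : Y → ℚ), a ∈ A → ι₀ (fun y => a (k • y)) = fun y => ι₀ a (k • y))
    (hι₁eq : ∀ (k : ℂ ≃+* ℂ) (a : Y → ℚ), a ∈ A → ι₁ (fun y => a (k • y)) = fun y => ι₁ a (k • y))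
    (hinj₀ : ∀ f ∈ A, ι₀ f = 0 → f = 0) (hinj₁ : ∀ f ∈ A, ι₁ f = 0 → f = 0)
    {b₀ b₁ : Y → ℚ} (hb₀ : b₀ ∈ A) (hb₁ : b₁ ∈ A) (hb₀0 : b₀ ≠ 0) (hb₁0 : b₁ ≠ 0)
    (hu₀ : antiVec (Φ i₀).1 (1 : ℂ ≃+* ℂ) = ι₀ b₀) (hu₁ : antiVec (Φ i₁).1 (1 : ℂ ≃+* ℂ) = ι₁ b₁) :
    CMAlgebra.cmFamilyRank Φ = cmTypeRank (Φ i₀) ↔ CMAlgebra.cmFamilyRank Φ = cmTypeRank (Φ i₁) := by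
  haveI : ∀ i, Nonempty (K i →+* ℂ) := fun i => inferInstance
  exact IrrOdd.typeRank_sigmaType_eq_typeRank_iff_swap_single (G := ℂ ≃+* ℂ) (E := fun i => K i →+* ℂ)
    (Φ := fun i => (Φ i).1) (fun i => isCMTypeWith_conj (Φ i)) hI h𝒟 hAst hAirr ι₀ ι₁ hι₀eq hι₁eq hinj₀ hinj₁ hb₀
    hb₁ hb₀0 hb₁0 hu₀ hu₁

end Summit.HodgeConjecture.CorCM

end
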